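import Mathlib
import Summits.PneNP.PneNP.Theorems.ClusUniversalCertificateCubeC

/-!
# Route ClusUniversalCertificate — crux `PairModelReduction` (stmt-PneNP-19684), line `birth`: the LiftCap interface

Route-independent definitions file (no `Theses` import) for the registered skeleton `birth` of crux
`Summit.PneNP.PneNP.Theses.ClusUniversalCertificate.PairModelReduction` (stmt-PneNP-19684, rung F-N1, cell pnp-ideate p1;
skeleton sha16 04524c82).  The skeleton's objects are the finite families of codimension-`≤ s` affine flats of the block
space `(𝔽₂^m)^n` and their unions — these are ALREADY in the tree, verbatim, as
`Summit.PneNP.PneNP.Theorems.ClusCube.Block.FlatFamily` / `FlatFamily.Y` (file `ClusUniversalCertificateCubeC`), so they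
are reused here rather than re-declared — and the statement `LiftCapSharpAll` (SHARP LiftCap (★) for all parameters, in `ℤ`),
stated VERBATIM from the skeleton over that structure.  The one theorem of this file is the route-independent content of the
registered stub `stub_liftCap_of_cert`: the block certificate `ClusCube.Block.UniversalCert n m` for all `n, m` implies
`LiftCapSharpAll` (on a union of codim-`≤ s` flats every point has certificate codimension `≤ s`,
`ClusCube.Block.codimIn_le_of_mem`).  The by-name stub (whose hypothesis is the route decl `UniversalCertAll`) is a separate
file importing the route file.  Scope: an interface lemma; the load-bearing stub of the line (`stub_polyloss_of_liftCap`,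
LiftCap ⇒ PolyLoss) is open, and nothing here bears on P vs NP.
-/

set_option linter.dupNamespace false -- `Summit.PneNP.PneNP.…`: summit = sub-problem name (D-0017 single-conjunct layout)

namespace Summit.PneNP.PneNP.Theorems.ClusPairModel

open Summit.PneNP.PneNP.Theorems.ClusCube.Block

/-- SHARP LiftCap (★) for all parameters: `(n - s)|Y| ≤ Σ_k 2^m |Y ∩ B_k|` for every union `Y` of codim-`≤ s` flats
(skeleton `birth` of stmt-PneNP-19684, verbatim; `FlatFamily` = the tree's `ClusCube.Block.FlatFamily`). -/
def LiftCapSharpAll : Prop :=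
  ∀ n m s : ℕ, ∀ Φ : FlatFamily n m s,
    ((n : ℤ) - s) * (Φ.Y.card : ℤ) ≤ ∑ k : Fin n, (2 : ℤ) ^ m * ((Φ.Y.filter fun y => y k = 0).card : ℤ)

/-- The block certificate for all `n, m` gives sharp LiftCap for every `s` (integer form, no case split on `s ≤ n`):
each point of the union lies on a flat of the family, so its certificate codimension is `≤ s`
(`ClusCube.Block.codimIn_le_of_mem`), and summing `n - s ≤ n - codim` over the union bounds `(n - s)|Y|` by the
certificate's left-hand side. [folklore; cell record Sketch-LiftCap.lean `liftCapSharp_of_universal`] -/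
theorem liftCapSharpAll_of_universalCert (h : ∀ n m : ℕ, UniversalCert n m) : LiftCapSharpAll := by
  intro n m s Φ
  have H := h n m Φ.Y
  have hpt : ∀ y ∈ Φ.Y, ((n : ℤ) - s) ≤ (n : ℤ) - (codimIn Φ.Y y : ℤ) := by
    intro y hy
    have hy' : ∃ f, y ∈ Φ.N f := by
      simpa [FlatFamily.Y] using hy
    obtain ⟨f, hf⟩ := hy'
    have hc : (codimIn Φ.Y y : ℤ) ≤ (s : ℤ) := by exact_mod_cast codimIn_le_of_mem Φ hf
    linarith
  calc ((n : ℤ) - s) * (Φ.Y.card : ℤ) = ∑ y ∈ Φ.Y, ((n : ℤ) - s) := by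
        rw [Finset.sum_const, nsmul_eq_mul, mul_comm]
    _ ≤ ∑ y ∈ Φ.Y, ((n : ℤ) - (codimIn Φ.Y y : ℤ)) := Finset.sum_le_sum hpt
    _ ≤ _ := H

end Summit.PneNP.PneNP.Theorems.ClusPairModel
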